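import Mathlib.Data.Real.Basic
import Mathlib.Tactic.Linarith
import Mathlib.Tactic.Ring
import Mathlib.Tactic.Positivity
import Mathlib.Tactic.FieldSimp
import HarnessLib

/-!
# Kozma–Nitzan Conjecture 1 on APEX-FOREST graphs (`G − b` a forest) — the algebraic induction step, machine-checked
# (`NoHeavyLowerTail` cell, stmt-CriticalPhenomena-4575; new-inequality factory seat `prim-ineq-gen-7`, gen 3)

Support file (`--supports stmt-CriticalPhenomena-4575`).  Pure real algebra: no measure theory, no definitions, no named facts, no sorries.

THE THEOREM this file serves (paper proof: run/shared/lean/prim/prim-ineq-gen-7/PROOF-CONJ1-APEXFOREST.md; census 0 / 1.6 M exact instances):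
**if `G − b` is a forest then for every `A` and every `o`,  `P(o ↔ A, o ↮ b) ≤ max_{a∈A} P(a ↮ b) · P(o ↔ A ∪ {b})`,** hence Kozma–Nitzan's
Conjecture 1 `P(o ↔ b) ≥ P(o ↔ A)·min_a P(a ↔ b)`, the event gluing `P(o↔A, o↮b) ≤ max_a P(a↮b)` (constant `1`) and the near-one gluing
`P(o↮b) ≤ P(o↮A) + max_a P(a↮b)` — uniformly in `|A|`, depth and branching; this is the lead's "binary Steiner-tree access" class
(LEAD-GEN6 §3c) with a blob/hub core (hub edges at arbitrary vertices, arbitrary weights).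
Proof = induction over the forest: detach one child subtree `T₁` (edge weight `q`) from the rest `T'` of the observer's tree; with
`a ≥ b` = P(the observer's `T'`-cluster avoids the hub) ≥ P(… and contains no relay), `g ≥ h` the same for the child's `T₁`-cluster,
`G = 1 − q(1−g)`, `H = 1 − q(1−h)`: the gluing quantity is `X = aG − bH`, `P(o ↔ A∪b) = 1 − bH`, and every relay `α` of a block contributes
`P(α ↮ b) = d_α − θ·e_α` with `θ = q(1−a)` (child block) / `q(1−g)` (root block), where `e_α ≤ X_block` ("a relay joined to the block root inside
a hub-free cluster witnesses 'root cluster hub-free with a relay'") and, by the induction hypothesis, `X_block ≤ d_{α*}(1 − h_block)` for the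
block's best relay.  This file proves exactly the real inequalities that close the step:

* `ApexForestAlgebra.twoBlock_caseI`, `twoBlock_caseII` — the TWO-BLOCK LEMMA in the parametrisation `μ = X/(1−h)` (conditional hub-avoidance
  of a block), `s = q(1−h)`: `(a−b)(1−s) + a s μ₁ ≤ V·(1 − b(1−s))` with `V = μ₁(1 − s(1−a))` if `μ₁ ≥ μ'`, `V = μ'(1 − s(1−b)(1−μ₁))` if `μ' ≥ μ₁`
  (two exact polynomial identities with manifestly nonnegative right-hand sides).
* `ApexForestAlgebra.step` — the INDUCTION STEP in certificate form: from block certificates `(d₁,e₁)`, `(d',e')` with `0 ≤ e ≤ X_block`,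
  `X_block ≤ d·(1 − h_block)` and `M ≥ d − θ e`, conclude `aG − bH ≤ M·(1 − bH)`.
* `ApexForestAlgebra.step_certificate` — the composed block again carries a certificate (`e_T ≤ X_T`, `X_T ≤ d_T(1 − h_T)`), so the step iterates.
The probabilistic identification of `a, b, g, h, d, e` with cluster probabilities (three elementary facts about clusters in `G − b` plus independence of
the two sides of a tree edge) is routine and is NOT in this file.
[cite: KozmaNitzan2024, Conjecture 1 (p. 3, (1)) and Theorem 1 / §3 (the cases proved in print)]
-/

namespace Summit.CriticalPhenomena.PercolationContinuityZ3.Theorems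

namespace ApexForestAlgebra

/-- **Two-block lemma, case I** (`μ₁ ≥ μ'`, the child block has the larger conditional hub-avoidance): with
`a = 1 − (1−b)(1−μ')`, the gluing quantity `(a−b)(1−s) + a s μ₁` is at most `μ₁(1 − s(1−a))·(1 − b(1−s))`.
Exact identity: `RHS − LHS = (1−s)(μ₁(1−b) − (a−b) + μ₁ s b (1−a))`. [this file] -/
theorem twoBlock_caseI (b μ' μ₁ s : ℝ) (hb0 : 0 ≤ b) (hb1 : b ≤ 1) (hμ'0 : 0 ≤ μ') (hμ₁1 : μ₁ ≤ 1)
    (hs0 : 0 ≤ s) (hs1 : s ≤ 1) (hcase : μ' ≤ μ₁) :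
    ((1 - (1 - b) * (1 - μ')) - b) * (1 - s) + (1 - (1 - b) * (1 - μ')) * s * μ₁ ≤
      μ₁ * (1 - s * (1 - (1 - (1 - b) * (1 - μ')))) * (1 - b * (1 - s)) := by
  have ha1 : 0 ≤ 1 - (1 - (1 - b) * (1 - μ')) := by nlinarith
  have key : μ₁ * (1 - s * (1 - (1 - (1 - b) * (1 - μ')))) * (1 - b * (1 - s)) -
      (((1 - (1 - b) * (1 - μ')) - b) * (1 - s) + (1 - (1 - b) * (1 - μ')) * s * μ₁) =
      (1 - s) * ((μ₁ - μ') * (1 - b) + μ₁ * s * b * ((1 - b) * (1 - μ'))) := by ring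
  have h1 : 0 ≤ (μ₁ - μ') * (1 - b) := mul_nonneg (by linarith) (by linarith)
  have h2 : 0 ≤ μ₁ * s * b * ((1 - b) * (1 - μ')) := by
    have : 0 ≤ μ₁ := le_trans hμ'0 hcase
    have : 0 ≤ (1 - b) * (1 - μ') := by nlinarith
    positivity
  nlinarith [mul_nonneg (by linarith : (0:ℝ) ≤ 1 - s) (add_nonneg h1 h2)]

/-- **Two-block lemma, case II** (`μ' ≥ μ₁`, the root block has the larger conditional hub-avoidance):
`(a−b)(1−s) + a s μ₁ ≤ μ'(1 − s(1−b)(1−μ₁))·(1 − b(1−s))`, `a = 1 − (1−b)(1−μ')`.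
Exact identity: `RHS − LHS = b s (μ' − μ₁) + μ' s b (1−b)(1−μ₁)(1−s)`. [this file] -/
theorem twoBlock_caseII (b μ' μ₁ s : ℝ) (hb0 : 0 ≤ b) (hb1 : b ≤ 1) (hμ'0 : 0 ≤ μ') (hμ₁1 : μ₁ ≤ 1)
    (hs0 : 0 ≤ s) (hs1 : s ≤ 1) (hcase : μ₁ ≤ μ') :
    ((1 - (1 - b) * (1 - μ')) - b) * (1 - s) + (1 - (1 - b) * (1 - μ')) * s * μ₁ ≤
      μ' * (1 - s * (1 - b) * (1 - μ₁)) * (1 - b * (1 - s)) := by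
  have key : μ' * (1 - s * (1 - b) * (1 - μ₁)) * (1 - b * (1 - s)) -
      (((1 - (1 - b) * (1 - μ')) - b) * (1 - s) + (1 - (1 - b) * (1 - μ')) * s * μ₁) =
      b * s * (μ' - μ₁) + μ' * s * b * (1 - b) * (1 - μ₁) * (1 - s) := by ring
  have h1 : 0 ≤ b * s * (μ' - μ₁) := by
    have : 0 ≤ μ' - μ₁ := by linarith
    positivity
  have h2 : 0 ≤ μ' * s * b * (1 - b) * (1 - μ₁) * (1 - s) := by
    have : 0 ≤ 1 - b := by linarith
    have : 0 ≤ 1 - μ₁ := by linarith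
    have : 0 ≤ 1 - s := by linarith
    positivity
  linarith

/-- **The induction step in certificate form.**  Root block `(a, b)` (`b ≤ a ≤ 1`: P(hub-free), P(hub-free and relay-free)), child block
`(g, h)`, edge weight `q`, `G = 1 − q(1−g)`, `H = 1 − q(1−h)`; block certificates `(d₁, e₁)` with `e₁ ≤ g − h`, `g − h ≤ d₁(1 − h)`,
`(d', e')` with `e' ≤ a − b`, `a − b ≤ d'(1 − b)`; and a number `M` dominating the two displaced relay values,
`d₁ − q(1−a)e₁ ≤ M` and `d' − q(1−g)e' ≤ M`.  Then the gluing quantity of the composed tree obeys `aG − bH ≤ M·(1 − bH)`.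
(For a block without relays take `d := M`, `e := 0`.) [this file] -/
theorem step (a b g h q M d₁ e₁ d' e' : ℝ) (hb0 : 0 ≤ b) (hba : b ≤ a) (ha1 : a ≤ 1)
    (hh0 : 0 ≤ h) (hhg : h ≤ g) (hg1 : g ≤ 1) (hq0 : 0 ≤ q) (hq1 : q ≤ 1)
    (he1X : e₁ ≤ g - h) (hd1 : g - h ≤ d₁ * (1 - h)) (hM1 : d₁ - q * (1 - a) * e₁ ≤ M)
    (he'X : e' ≤ a - b) (hd' : a - b ≤ d' * (1 - b)) (hM' : d' - q * (1 - g) * e' ≤ M) :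
    a * (1 - q * (1 - g)) - b * (1 - q * (1 - h)) ≤ M * (1 - b * (1 - q * (1 - h))) := by
  have hY : 0 ≤ 1 - b * (1 - q * (1 - h)) := by
    have hH1 : 1 - q * (1 - h) ≤ 1 := by nlinarith
    have hHb : b * (1 - q * (1 - h)) ≤ 1 * 1 :=
      mul_le_mul (le_trans hba ha1) hH1 (by nlinarith) zero_le_one
    linarith
  -- degenerate root block `b = 1`
  by_cases hb : b = 1
  · subst hb
    have ha : a = 1 := le_antisymm ha1 hba
    subst ha
    -- LHS = q (g - h), RHS = M q (1 - h); need (g-h) ≤ M (1-h)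
    by_cases hh : h = 1
    · subst hh
      have hg : g = 1 := le_antisymm hg1 hhg
      subst hg; simp
    · have h1h : 0 < 1 - h := by
        rcases lt_or_eq_of_le (show h ≤ 1 from le_trans hhg hg1) with hlt | heq
        · linarith
        · exact absurd heq hh
      -- from hd1 and hM1 (with 1 - a = 0): M ≥ d₁ ≥ (g-h)/(1-h)
      have hMd : d₁ ≤ M := by simpa using hM1
      have : g - h ≤ M * (1 - h) := le_trans hd1 (by nlinarith)
      nlinarith
  -- degenerate child block `h = 1`
  by_cases hh : h = 1
  · subst hh
    have hg : g = 1 := le_antisymm hg1 hhg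
    subst hg
    -- G = H = 1: LHS = a - b ≤ d' (1-b) and M ≥ d' (θ' = 0)
    have hMd : d' ≤ M := by simpa using hM'
    have h1b : 0 ≤ 1 - b := by linarith
    nlinarith [mul_le_mul_of_nonneg_right hMd h1b]
  have h1b : 0 < 1 - b := by
    rcases lt_or_eq_of_le (show b ≤ 1 from le_trans hba ha1) with hlt | heq
    · linarith
    · exact absurd heq hb
  have h1h : 0 < 1 - h := by
    rcases lt_or_eq_of_le (show h ≤ 1 from le_trans hhg hg1) with hlt | heq
    · linarith
    · exact absurd heq hh
  -- conditional hub-avoidances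
  set μ₁ : ℝ := (g - h) / (1 - h) with hμ₁
  set μ' : ℝ := (a - b) / (1 - b) with hμ'
  set s : ℝ := q * (1 - h) with hs
  have hμ₁0 : 0 ≤ μ₁ := div_nonneg (by linarith) h1h.le
  have hμ₁1 : μ₁ ≤ 1 := by rw [hμ₁, div_le_one h1h]; linarith
  have hμ'0 : 0 ≤ μ' := div_nonneg (by linarith) h1b.le
  have hμ'1 : μ' ≤ 1 := by rw [hμ', div_le_one h1b]; linarith
  have hs0 : 0 ≤ s := mul_nonneg hq0 h1h.le
  have hs1 : s ≤ 1 := by rw [hs]; nlinarith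
  have hg_eq : g = 1 - (1 - h) * (1 - μ₁) := by rw [hμ₁]; field_simp; ring
  have ha_eq : a = 1 - (1 - b) * (1 - μ')  := by rw [hμ']; field_simp; ring
  -- `M` dominates both block values
  have hV1 : μ₁ * (1 - s * (1 - a)) ≤ M := by
    -- d₁ - q(1-a)e₁ ≥ (g-h)/(1-h) - q(1-a)(g-h)
    have hd1' : μ₁ ≤ d₁ := by rw [hμ₁, div_le_iff₀ h1h]; linarith
    have hqa : 0 ≤ q * (1 - a) := mul_nonneg hq0 (by linarith)
    have : μ₁ - q * (1 - a) * (g - h) ≤ d₁ - q * (1 - a) * e₁ := by nlinarith [mul_le_mul_of_nonneg_left he1X hqa]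
    have hrew : μ₁ * (1 - s * (1 - a)) = μ₁ - q * (1 - a) * (g - h) := by
      rw [hs, hg_eq]; ring
    linarith
  have hV' : μ' * (1 - s * (1 - b) * (1 - μ₁)) ≤ M := by
    have hd'' : μ' ≤ d' := by rw [hμ', div_le_iff₀ h1b]; linarith
    have hqg : 0 ≤ q * (1 - g) := mul_nonneg hq0 (by linarith)
    have : μ' - q * (1 - g) * (a - b) ≤ d' - q * (1 - g) * e' := by nlinarith [mul_le_mul_of_nonneg_left he'X hqg]
    have hrew : μ' * (1 - s * (1 - b) * (1 - μ₁)) = μ' - q * (1 - g) * (a - b) := by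
      rw [hs, hg_eq, ha_eq]; ring
    linarith
  -- rewrite the goal in the (μ, s) parametrisation
  have hLHS : a * (1 - q * (1 - g)) - b * (1 - q * (1 - h)) = (a - b) * (1 - s) + a * s * μ₁ := by
    rw [hs, hg_eq]; ring
  have hYeq : 1 - b * (1 - q * (1 - h)) = 1 - b * (1 - s) := by rw [hs]
  rw [hLHS, hYeq]
  have hY' : 0 ≤ 1 - b * (1 - s) := by rw [← hYeq]; exact hY
  rcases le_total μ' μ₁ with hcase | hcase
  · have h2b := twoBlock_caseI b μ' μ₁ s hb0 (le_trans hba ha1) hμ'0 hμ₁1 hs0 hs1 hcase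
    rw [← ha_eq] at h2b
    exact le_trans h2b (mul_le_mul_of_nonneg_right hV1 hY')
  · have h2b := twoBlock_caseII b μ' μ₁ s hb0 (le_trans hba ha1) hμ'0 hμ₁1 hs0 hs1 hcase
    rw [← ha_eq] at h2b
    exact le_trans h2b (mul_le_mul_of_nonneg_right hV' hY')

/-- **The composed block carries a certificate again** (so `step` iterates down the forest): with the data of `step`, the composed
tree has `g_T = aG`, `h_T = bH`, `X_T = aG − bH`; the child's relay gives `(d_T, e_T) = (d₁ − q(1−a)e₁, e₁·q·a)`, the root block's relay gives
`(d_T, e_T) = (d' − q(1−g)e', e'·G)`; in both cases `0 ≤ e_T ≤ X_T`, and for the better of the two `X_T ≤ d_T·(1 − h_T)`.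
[this file] -/
theorem step_certificate (a b g h q d₁ e₁ d' e' : ℝ) (hb0 : 0 ≤ b) (hba : b ≤ a) (ha1 : a ≤ 1)
    (hh0 : 0 ≤ h) (hhg : h ≤ g) (hg1 : g ≤ 1) (hq0 : 0 ≤ q) (hq1 : q ≤ 1)
    (he1 : 0 ≤ e₁) (he1X : e₁ ≤ g - h) (hd1 : g - h ≤ d₁ * (1 - h))
    (he' : 0 ≤ e') (he'X : e' ≤ a - b) (hd' : a - b ≤ d' * (1 - b)) :
    (0 ≤ e₁ * q * a ∧ e₁ * q * a ≤ a * (1 - q * (1 - g)) - b * (1 - q * (1 - h))) ∧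
    (0 ≤ e' * (1 - q * (1 - g)) ∧ e' * (1 - q * (1 - g)) ≤ a * (1 - q * (1 - g)) - b * (1 - q * (1 - h))) ∧
    a * (1 - q * (1 - g)) - b * (1 - q * (1 - h)) ≤
      max (d₁ - q * (1 - a) * e₁) (d' - q * (1 - g) * e') * (1 - b * (1 - q * (1 - h))) := by
  have ha0 : 0 ≤ a := le_trans hb0 hba
  have hG0 : 0 ≤ 1 - q * (1 - g) := by nlinarith
  refine ⟨⟨by positivity, ?_⟩, ⟨mul_nonneg he' hG0, ?_⟩, ?_⟩
  · -- e₁ q a ≤ a q (g-h) ≤ X_T = a q (g-h) + (a-b) H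
    have hH0 : 0 ≤ 1 - q * (1 - h) := by nlinarith
    nlinarith [mul_le_mul_of_nonneg_left he1X (mul_nonneg hq0 ha0), mul_nonneg (sub_nonneg.2 hba) hH0]
  · -- e' G ≤ (a-b) G ≤ X_T  (X_T - (a-b)G = b q (g-h) ≥ 0)
    nlinarith [mul_le_mul_of_nonneg_right he'X hG0, mul_nonneg (mul_nonneg hb0 hq0) (sub_nonneg.2 hhg)]
  · exact step a b g h q _ d₁ e₁ d' e' hb0 hba ha1 hh0 hhg hg1 hq0 hq1 he1X hd1 (le_max_left _ _)
      he'X hd' (le_max_right _ _)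

end ApexForestAlgebra

end Summit.CriticalPhenomena.PercolationContinuityZ3.Theorems
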